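import Literature.NumberTheory.Rogawski1990.EndoscopicCentralizerIso
import HarnessLib

/-!
# The local endoscopic torus transport `θ : Z_{H_v}(γ_H) ≃ₜ* Z_{G′_v}(γ)` carries norm pairs and `G`-regularity along the torus

Topic `NumberTheory/Rogawski1990`; namespace `Literature.NumberTheory.Rogawski1990`.  THEOREMS ONLY (existence form; no definition, no named fact, no
instance, no `sorry`).  Cell `hodgecm-mathlib` (D-0151), programme P3a, LEAD F0P3a-plan (g9) T8-25 (B) ∕ T8-26; the «(Θ) TORUS TRANSPORT» feeder of the
N6-ns junction `Rogawski1990/LocalTransferChartJunctionCM.lean` in F0P2-p02 (g8)'s torus-form spec (F0∕P3a bus 2026-09-01T02:43:45Z).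

THE MATHEMATICS ([Rogawski1990, §4.3 pp. 42–44]; [LanglandsShelstad1987, §1.3]).  At a finite place `v` of `L⁺`, for `γ_H ∈ H_v = U(Φ₂)(L⁺_v) ×
U(Φ₁)(L⁺_v)` `G`-regular (★ `IsLocalGRegular`) and `γ ∈ G′_v = U(H′)(L⁺_v)` with `γ_H → γ` (★ `IsLocalNormPair`, i.e. `y ι_v(γ_H) y⁻¹ = γ` for some
`y ∈ GL₃(∏_{w∣v} L_w)`), the tree's ★ `exists_localEndoCentralizerEquiv` gives `θ : Z_{H_v}(γ_H) ≃ₜ* Z_{G′_v}(γ)` with `θ(t) = y · ι_v(t) · y⁻¹` for ANY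
such conjugator `y` — (Θ).  Reading this value formula once: **(Θ1) every `t ∈ Z_{H_v}(γ_H)` matches its image, `t → θ(t)`** (the same `y` conjugates
`ι_v(t)` to `θ(t)`), and **(Θ2) `θ` carries `G`-regular elements of the torus to regular elements of `G′_v`** (★ `isRegularElt_of_isConj`).  One
existential package `exists_localEndoCentralizerEquiv_normPair` = (Θ) ∧ (Θ1) ∧ (Θ2), the junction's `θ`.
HC_CM is proved only modulo the printed citations until rung 0 closes; this file discharges no named fact.

## References
* [Rogawski1990] J. D. Rogawski, *Automorphic Representations of Unitary Groups in Three Variables*, Ann. of Math. Stud. 123 (1990), §4.3 pp. 42–44, §4.9 p. 54.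
* [LanglandsShelstad1987] R. P. Langlands, D. Shelstad, *On the definition of transfer factors*, Math. Ann. 278 (1987), §1.3.
-/

set_option autoImplicit false

noncomputable section

open NumberField IsDedekindDomain Topology
open scoped Matrix MatrixGroups

namespace Literature.NumberTheory.Rogawski1990

open Literature.NumberTheory.Automorphic Literature.NumberTheory.Automorphic.UnitaryGroup

variable (L : Type) [Field L] [NumberField L] [IsCMField L] {H' : Matrix (Fin 3) (Fin 3) L}

/-- **(Θ) ∧ (Θ1) ∧ (Θ2): THE LOCAL ENDOSCOPIC TORUS TRANSPORT CARRIES NORM PAIRS AND `G`-REGULARITY.**  For `γ_H ∈ H_v` `G`-regular and `γ ∈ U(H′)(L⁺_v)`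
with `γ_H → γ` (`det H′ ≠ 0`): there is `θ : Z_{H_v}(γ_H) ≃ₜ* Z_{U(H′)(L⁺_v)}(γ)` such that (Θ) `θ(t) = y · ι_v(t) · y⁻¹` in `GL₃(∏_{w∣v} L_w)` for EVERY
conjugator `y` with `y ι_v(γ_H) y⁻¹ = γ` (★ `exists_localEndoCentralizerEquiv`); (Θ1) `t → θ(t)` (★ `IsLocalNormPair`) for every `t` in the torus; (Θ2)
`t` `G`-regular ⇒ `θ(t)` regular (★ `IsRegularElt`, via ★ `isRegularElt_of_isConj`). [cite: Rogawski1990, §4.3 pp. 42–44; §4.9 p. 54]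
[cite: LanglandsShelstad1987, §1.3] -/
theorem exists_localEndoCentralizerEquiv_normPair (v : HeightOneSpectrum (𝓞 ↥(maximalRealSubfield L))) (hH' : H'.det ≠ 0)
    {γH : (cmDatum L 2 (Matrix.of fun i j : Fin 2 => if i.val + j.val + 1 = 2 then (1 : L) else 0)).Local v ×
      (cmDatum L 1 (Matrix.of fun i j : Fin 1 => if i.val + j.val + 1 = 1 then (1 : L) else 0)).Local v}
    {γ : (cmDatum L 3 H').Local v} (hreg : IsLocalGRegular L v γH) (hm : IsLocalNormPair L H' v γH γ) :
    ∃ e : Subgroup.centralizer ({γH} : Set ((cmDatum L 2 (Matrix.of fun i j : Fin 2 => if i.val + j.val + 1 = 2 then (1 : L) else 0)).Local v ×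
          (cmDatum L 1 (Matrix.of fun i j : Fin 1 => if i.val + j.val + 1 = 1 then (1 : L) else 0)).Local v)) ≃ₜ*
        Subgroup.centralizer ({γ} : Set ((cmDatum L 3 H').Local v)),
      (∀ (y : GL (Fin 3) (LocalRing L v)), y * ((endoEmbLocal L v γH).val : GL (Fin 3) (LocalRing L v)) * y⁻¹ = γ.val →
        ∀ z, ((e z).1.val : GL (Fin 3) (LocalRing L v)) = y * ((endoEmbLocal L v z.1).val : GL (Fin 3) (LocalRing L v)) * y⁻¹) ∧
      (∀ z, IsLocalNormPair L H' v z.1 (e z).1) ∧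
      (∀ z, IsLocalGRegular L v z.1 → IsRegularElt (((e z).1).val : GL (Fin 3) (LocalRing L v))) := by
  obtain ⟨e, he⟩ := exists_localEndoCentralizerEquiv L v hH' hreg hm
  -- one conjugator `y` for `γ_H → γ`
  obtain ⟨y, hy⟩ := isConj_iff.1 hm
  have hconj : ∀ z, IsConj ((endoEmbLocal L v z.1).val : GL (Fin 3) (LocalRing L v)) (((e z).1).val : GL (Fin 3) (LocalRing L v)) :=
    fun z => isConj_iff.2 ⟨y, (he y hy z).symm⟩
  exact ⟨e, he, fun z => hconj z, fun z hz => isRegularElt_of_isConj (hconj z) hz⟩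

/-- **(Θ1)∕(Θ2) for ANY transport with the value formula** (the shape a consumer holding its own `θ` and conjugator `y` uses): if `y ι_v(γ_H) y⁻¹ = γ` and
`θ(t) = y ι_v(t) y⁻¹` on the torus, then `t → θ(t)` and `G`-regularity of `t` gives regularity of `θ(t)`. [cite: Rogawski1990, §4.3 pp. 42–44] -/
theorem isLocalNormPair_and_isRegularElt_of_conj_eq (v : HeightOneSpectrum (𝓞 ↥(maximalRealSubfield L)))
    {γH : (cmDatum L 2 (Matrix.of fun i j : Fin 2 => if i.val + j.val + 1 = 2 then (1 : L) else 0)).Local v ×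
      (cmDatum L 1 (Matrix.of fun i j : Fin 1 => if i.val + j.val + 1 = 1 then (1 : L) else 0)).Local v}
    {γ : (cmDatum L 3 H').Local v}
    (θ : Subgroup.centralizer ({γH} : Set ((cmDatum L 2 (Matrix.of fun i j : Fin 2 => if i.val + j.val + 1 = 2 then (1 : L) else 0)).Local v ×
          (cmDatum L 1 (Matrix.of fun i j : Fin 1 => if i.val + j.val + 1 = 1 then (1 : L) else 0)).Local v)) →
        Subgroup.centralizer ({γ} : Set ((cmDatum L 3 H').Local v)))
    (y : GL (Fin 3) (LocalRing L v))
    (hθ : ∀ z, ((θ z).1.val : GL (Fin 3) (LocalRing L v)) = y * ((endoEmbLocal L v z.1).val : GL (Fin 3) (LocalRing L v)) * y⁻¹)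
    (z : Subgroup.centralizer ({γH} : Set ((cmDatum L 2 (Matrix.of fun i j : Fin 2 => if i.val + j.val + 1 = 2 then (1 : L) else 0)).Local v ×
          (cmDatum L 1 (Matrix.of fun i j : Fin 1 => if i.val + j.val + 1 = 1 then (1 : L) else 0)).Local v))) :
    IsLocalNormPair L H' v z.1 (θ z).1 ∧ (IsLocalGRegular L v z.1 → IsRegularElt (((θ z).1).val : GL (Fin 3) (LocalRing L v))) :=
  have hconj : IsConj ((endoEmbLocal L v z.1).val : GL (Fin 3) (LocalRing L v)) (((θ z).1).val : GL (Fin 3) (LocalRing L v)) :=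
    isConj_iff.2 ⟨y, (hθ z).symm⟩
  ⟨hconj, fun hz => isRegularElt_of_isConj hconj hz⟩

end Literature.NumberTheory.Rogawski1990

end
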